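import Summits.Ventures.Crystal3D.Theorems.StickyWulffConstantGenericWallFloorConeCertificate
import HarnessLib

/-!
# Cone certificates: the AGGREGATE tube radius `ρ` (add-on to `…ConeCertificate`)

Helper for `stmt-Ventures-19480` (E1, inside-tube half).  The landed glue `ConeCert.eq_slots` /
`eq_slots_sharp` certify the per-ball tube radius `κ₀/3` resp. `3κ₀/5` by bounding ONE violated
active contact by the worst second-order constant `3/2`.  Here the certificate identity is used as a
single inequality (`ConeCert.aggregate`: `(r|τ|/√2) ‖v i₀‖ ≤ Σ_own λ L̃ + Σ_free λ L̃`), each term is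
bounded by ITS OWN second-order constant (own `¼`, free `3/2` — the landed one-contact lemmas of
`…TubeLemma`), and the tangent norm `‖v i₀‖² = ε² − ε⁴/4` is kept exactly.  Result: with
`B = Λ_own + 6 Λ_free` and a candidate radius `ρ = p/q` passing the integer check
`ConeCert.rhoCheck p q` — `ρ² (N B² + 2 r²|τ|²) ≤ 8 r²|τ|²` for every `(i₀, a, ±)` —
**`ConeCert.eq_slots_rho`**: every admissible completion with each free ball within chord `ρ` of
its slot IS the slot configuration (`eq_slots_rho_dist`: the same with `1 ≤ dist` hypotheses).
Finset form for the E1 ↔ E2 interface (wulff-p2 22:32:54Z): `ConeCert.eq_slotSet_of_etaMatched`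
(`EtaMatched η T (slot set)` with `η < ρ` ⇒ `T =` slot set; also `…_kappa` with `η < κ₀/3`),
needing only slot-injectivity (one `decide`).
No new structure fields: `rhoCheck` takes `p q` as arguments, so the landed certificates
`cert_<frame>_<rep>` get their radius by one more `decide` each (files `…ConeCertRho*.lean`).
Typical values (lit g11 TABLE.md): `ρ = 1.154` for `|O| = 11`, `ρ ≥ 0.108` (median `0.2`) on the fcc
`|O| = 7` rows versus `κ₀/3 = 0.039`; always `ρ ≥ 1.15 κ₀`.  lit g11 (crystal3d-full; HOME/cf-lit/lean/conecert/,
README-CONE §8), landed by prover 19480-p2. -/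

noncomputable section

namespace Summit.Ventures.Crystal3D.Theorems

open Finset Literature.Geometry.DiscreteGeometry
open scoped RealInnerProductSpace

namespace ConeCert

variable {m : ℕ} (C : ConeCert m)

/-- Second-order weight `B = Λ_own + 6 Λ_free` of the certificate for `(i₀, a, b)` (the tube lemma's
second-order constants `1/4` (own) and `3/2` (free) are in ratio `1 : 6`). -/
def B (i₀ : Fin m) (a : Fin 2) (b : Bool) : ℕ :=
  (∑ c : Fin C.nO, C.lamO i₀ a b c) + 6 * ∑ c : Fin C.nF, C.lamF i₀ a b c

/-- The integer check that `ρ = p/q` is an admissible AGGREGATE tube radius for `C`: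
`ρ² (N B² + 2 r² |τ|²) ≤ 8 r² |τ|²` for every `(i₀, a, b)` (`τ = tau i₀ a`), i.e.
`ρ ≤ γ/√(1 + γ²/4)` with `γ = 4 r |τ| / (B √(2N))`. -/
def rhoCheck (C : ConeCert m) (p q : ℕ) : Bool := decide (
  0 < q ∧ 0 < p ∧
  (∀ i₀ : Fin m, ∀ a : Fin 2, ∀ b : Bool,
    (p : ℤ) ^ 2 * ((C.N : ℤ) * (C.B i₀ a b : ℤ) ^ 2 +
        2 * (C.r i₀ a b : ℤ) ^ 2 * dotInt (C.tau i₀ a) (C.tau i₀ a)) ≤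
      8 * (C.r i₀ a b : ℤ) ^ 2 * dotInt (C.tau i₀ a) (C.tau i₀ a) * (q : ℤ) ^ 2))

/-- The aggregate first-order inequality behind `margin`: for every tangent field `v` and ball `i₀`
some certificate direction `(a, b)` has
`(r |τ| / √2) ‖v i₀‖ ≤ Σ_own λ ⟪v_i, own⟫ + Σ_free λ (⟪v_A, slot_B⟫ + ⟪v_B, slot_A⟫)` (integer-scaled
own/slot vectors). -/
theorem aggregate (hV : C.check = true) (v : Fin m → (EuclideanSpace ℝ (Fin 3))) (hv : ∀ i, ⟪v i, C.s i⟫ = 0) (i₀ : Fin m) :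
    ∃ a : Fin 2, ∃ b : Bool,
      (C.r i₀ a b : ℝ) * ‖intVec (C.tau i₀ a)‖ / Real.sqrt 2 * ‖v i₀‖ ≤
        (∑ c : Fin C.nO, (C.lamO i₀ a b c : ℝ) * ⟪v (C.ownBall c), intVec (C.ownVec c)⟫) +
        ∑ c : Fin C.nF, (C.lamF i₀ a b c : ℝ) *
          (⟪v (C.freeA c), intVec (C.slot (C.freeB c))⟫ +
            ⟪v (C.freeB c), intVec (C.slot (C.freeA c))⟫) := by
  classical
  unfold ConeCert.check at hV
  obtain ⟨hN, -, -, -, htan, hcert, -⟩ := of_decide_eq_true hV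
  have hsqpos := C.sqrtN_pos hN
  have hcNpos : 0 < (Real.sqrt C.N)⁻¹ := inv_pos.2 hsqpos
  have hvI : ∀ i, ⟪v i, intVec (C.slot i)⟫ = 0 := by
    intro i
    have h := hv i
    rw [ConeCert.s, real_inner_smul_right] at h
    rcases mul_eq_zero.1 h with h | h
    · exact absurd h hcNpos.ne'
    · exact h
  obtain ⟨hS0, hT0, hT1, hST0, hST1, hT01⟩ := htan i₀
  obtain ⟨a, b, hdir, hsgn⟩ := exists_dir_of_frame (w := v i₀) (T := fun a => intVec (C.tau i₀ a))
    (intVec_ne_zero hS0) (intVec_ne_zero hT0) (intVec_ne_zero hT1)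
    (by rw [inner_intVec]; exact_mod_cast hST0)
    (by rw [inner_intVec]; exact_mod_cast hST1)
    (by rw [inner_intVec]; exact_mod_cast hT01) (hvI i₀)
  refine ⟨a, b, ?_⟩
  set Ta : (EuclideanSpace ℝ (Fin 3)) := intVec (C.tau i₀ a) with hTa
  obtain ⟨hr, -, hid, -⟩ := hcert i₀ a b
  set t : ℝ := (sgn b : ℝ) * ⟪v i₀, Ta⟫ with ht
  have ht0 : 0 ≤ t := hsgn
  have hsum : (∑ c : Fin C.nO, (C.lamO i₀ a b c : ℝ) * ⟪v (C.ownBall c), intVec (C.ownVec c)⟫) +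
      ∑ c : Fin C.nF, (C.lamF i₀ a b c : ℝ) *
        (⟪v (C.freeA c), intVec (C.slot (C.freeB c))⟫ +
          ⟪v (C.freeB c), intVec (C.slot (C.freeA c))⟫) = (C.r i₀ a b : ℝ) * t := by
    rw [← C.sum_inner_grad i₀ a b v]
    have : ∀ i, ⟪v i, intVec (C.grad i₀ a b i)⟫ =
        if i = i₀ then (C.r i₀ a b : ℝ) * t else 0 := by
      intro i
      rw [hid i, intVec_add, inner_add_right, intVec_zsmul, real_inner_smul_right, hvI i, mul_zero,
        zero_add]
      split_ifs with h
      · subst h; rw [intVec_zsmul, real_inner_smul_right, ht, hTa]; push_cast; ring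
      · rw [intVec_zero, inner_zero_right]
    simp_rw [this]
    rw [Finset.sum_ite_eq' Finset.univ i₀]; simp
  rw [hsum]
  have hs2 : (0 : ℝ) < Real.sqrt 2 := Real.sqrt_pos.2 (by norm_num)
  have htsq : ⟪v i₀, Ta⟫ ^ 2 = t ^ 2 := by
    rw [ht, mul_pow]; cases b <;> simp [sgn]
  have hwT : ‖v i₀‖ * ‖Ta‖ ≤ Real.sqrt 2 * t := by
    have h2 : (‖v i₀‖ * ‖Ta‖) ^ 2 ≤ (Real.sqrt 2 * t) ^ 2 := by
      rw [mul_pow, mul_pow, Real.sq_sqrt (by norm_num), ← htsq]; exact hdir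
    exact (pow_le_pow_iff_left₀ (by positivity) (by positivity) two_ne_zero).1 h2
  rw [div_mul_eq_mul_div, div_le_iff₀ hs2]
  have hr0 : (0 : ℝ) ≤ C.r i₀ a b := by positivity
  calc (C.r i₀ a b : ℝ) * ‖Ta‖ * ‖v i₀‖ = (C.r i₀ a b : ℝ) * (‖v i₀‖ * ‖Ta‖) := by ring
    _ ≤ (C.r i₀ a b : ℝ) * (Real.sqrt 2 * t) := mul_le_mul_of_nonneg_left hwT hr0
    _ = (C.r i₀ a b : ℝ) * t * Real.sqrt 2 := by ring

/-- **Exact capping inside the AGGREGATE tube.**  For a valid certificate, every admissible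
completion with each free ball within chord distance `ρ = p/q` (any `p q` passing `C.rhoCheck p q`) of its slot is the slot
configuration.  (Second-order bookkeeping: the certificate's weighted sum of linearised constraints
is `≥ (r|τ|/√2) ‖v i₀‖` with `‖v i₀‖² = ε² − ε⁴/4` at the maximal displacement `ε`, and
`≤ √N (Λ_own/4 + 3Λ_free/2) ε² = √N (B/4) ε²` by the landed one-contact bounds; squaring gives
`8 r²|τ|² ≤ ε² (N B² + 2 r²|τ|²)` for `ε > 0`, incompatible with the check
`ρ² (N B² + 2 r²|τ|²) ≤ 8 r²|τ|²` when `ε < ρ`.) -/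
theorem eq_slots_rho (hV : C.check = true) {p q : ℕ} (hρ : C.rhoCheck p q = true)
    {x : Fin m → (EuclideanSpace ℝ (Fin 3))} (hx : ∀ i, ‖x i‖ = 1)
    (hxo : ∀ i, ∀ o ∈ C.ownSet, ⟪C.s i, o⟫ = 1 / 2 → ⟪x i, o⟫ ≤ 1 / 2)
    (hxx : ∀ i j, i ≠ j → ⟪C.s i, C.s j⟫ = 1 / 2 → ⟪x i, x j⟫ ≤ 1 / 2)
    (hclose : ∀ i, ‖x i - C.s i‖ < (p : ℝ) / q) : x = C.s := by
  classical
  have hV' := hV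
  unfold ConeCert.check at hV'
  obtain ⟨hN, -, hown, hfree, htan, hcert, -⟩ := of_decide_eq_true hV'
  clear hV'
  unfold ConeCert.rhoCheck at hρ
  obtain ⟨hrden, -, hrho⟩ := of_decide_eq_true hρ
  clear hρ
  have hsqpos := C.sqrtN_pos hN
  -- displacement, its maximum, tangent parts
  set v : Fin m → (EuclideanSpace ℝ (Fin 3)) := fun i => (x i - C.s i) + (‖x i - C.s i‖ ^ 2 / 2) • C.s i with hvdef
  have hvt : ∀ i, ⟪v i, C.s i⟫ = 0 := fun i => inner_tangentPart_eq_zero (C.norm_s hV i) (hx i)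
  rcases isEmpty_or_nonempty (Fin m) with hι | hι
  · funext i; exact (hι.false i).elim
  obtain ⟨i₀, hi₀⟩ := Finite.exists_max fun i => ‖x i - C.s i‖
  set ε := ‖x i₀ - C.s i₀‖ with hεdef
  have hε0 : 0 ≤ ε := norm_nonneg _
  have hεi : ∀ i, ‖x i - C.s i‖ ≤ ε := hi₀
  have hερ : ε < (p : ℝ) / q := hclose i₀
  have hvsq : ‖v i₀‖ ^ 2 = ε ^ 2 - ε ^ 4 / 4 := norm_tangentPart_sq (C.norm_s hV i₀) (hx i₀)
  -- the aggregate inequality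
  obtain ⟨a, b, hagg⟩ := C.aggregate hV v hvt i₀
  obtain ⟨hS0, hT0, hT1, -⟩ := htan i₀
  obtain ⟨hr, -, -, -⟩ := hcert i₀ a b
  set Ta : (EuclideanSpace ℝ (Fin 3)) := intVec (C.tau i₀ a) with hTa
  have hTpos : 0 < ‖Ta‖ := by
    have : Ta ≠ 0 := by
      rw [hTa]; fin_cases a <;> [exact intVec_ne_zero hT0; exact intVec_ne_zero hT1]
    exact norm_pos_iff.2 this
  have hna : ‖Ta‖ ^ 2 = (dotInt (C.tau i₀ a) (C.tau i₀ a) : ℝ) := by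
    rw [← real_inner_self_eq_norm_sq, hTa]; exact inner_intVec _ _
  -- second-order upper bound of the aggregate: ≤ √N (B/4) ε²
  have hownb : ∀ c : Fin C.nO,
      ⟪v (C.ownBall c), intVec (C.ownVec c)⟫ ≤ Real.sqrt C.N * (ε ^ 2 / 4) := by
    intro c
    set o : (EuclideanSpace ℝ (Fin 3)) := (Real.sqrt C.N)⁻¹ • intVec (C.ownVec c) with hodef
    have ho : o ∈ C.ownSet := Finset.mem_image_of_mem _ (Finset.mem_univ c)
    have hso : ⟪C.s (C.ownBall c), o⟫ = 1 / 2 := C.inner_s_own hN c (hown c).1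
    have heq : intVec (C.ownVec c) = Real.sqrt C.N • o := by
      rw [hodef, smul_smul, mul_inv_cancel₀ hsqpos.ne', one_smul]
    have h1 : ⟪v (C.ownBall c), o⟫ ≤ ‖x (C.ownBall c) - C.s (C.ownBall c)‖ ^ 2 / 4 :=
      inner_tangentPart_own_le hso (hxo _ o ho hso)
    have h2 : ‖x (C.ownBall c) - C.s (C.ownBall c)‖ ^ 2 ≤ ε ^ 2 :=
      pow_le_pow_left₀ (norm_nonneg _) (hεi _) 2
    rw [heq, real_inner_smul_right]
    have : ⟪v (C.ownBall c), o⟫ ≤ ε ^ 2 / 4 := by linarith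
    exact mul_le_mul_of_nonneg_left this hsqpos.le
  have hfreeb : ∀ c : Fin C.nF,
      ⟪v (C.freeA c), intVec (C.slot (C.freeB c))⟫ + ⟪v (C.freeB c), intVec (C.slot (C.freeA c))⟫ ≤
        Real.sqrt C.N * (3 / 2 * ε ^ 2) := by
    intro c
    have hss : ⟪C.s (C.freeA c), C.s (C.freeB c)⟫ = 1 / 2 := C.inner_s_s hN c (hfree c).2
    have heqA : intVec (C.slot (C.freeA c)) = Real.sqrt C.N • C.s (C.freeA c) := by
      rw [ConeCert.s, smul_smul, mul_inv_cancel₀ hsqpos.ne', one_smul]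
    have heqB : intVec (C.slot (C.freeB c)) = Real.sqrt C.N • C.s (C.freeB c) := by
      rw [ConeCert.s, smul_smul, mul_inv_cancel₀ hsqpos.ne', one_smul]
    have h1 := inner_tangentPart_free_le hss (hxx _ _ (hfree c).1 hss)
    have h2 : ‖x (C.freeA c) - C.s (C.freeA c)‖ ^ 2 ≤ ε ^ 2 :=
      pow_le_pow_left₀ (norm_nonneg _) (hεi _) 2
    have h3 : ‖x (C.freeB c) - C.s (C.freeB c)‖ ^ 2 ≤ ε ^ 2 :=
      pow_le_pow_left₀ (norm_nonneg _) (hεi _) 2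
    have h4 : ‖x (C.freeA c) - C.s (C.freeA c)‖ * ‖x (C.freeB c) - C.s (C.freeB c)‖ ≤ ε * ε :=
      mul_le_mul (hεi _) (hεi _) (norm_nonneg _) hε0
    rw [heqA, heqB, real_inner_smul_right, real_inner_smul_right,
      real_inner_comm (C.s (C.freeA c)) (v (C.freeB c)), ← mul_add]
    refine mul_le_mul_of_nonneg_left ?_ hsqpos.le
    have : ⟪v (C.freeA c), C.s (C.freeB c)⟫ + ⟪C.s (C.freeA c), v (C.freeB c)⟫ ≤
        ε * ε + (ε ^ 2 + ε ^ 2) / 4 := by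
      refine h1.trans ?_; nlinarith
    nlinarith
  have hup : (∑ c : Fin C.nO, (C.lamO i₀ a b c : ℝ) * ⟪v (C.ownBall c), intVec (C.ownVec c)⟫) +
      ∑ c : Fin C.nF, (C.lamF i₀ a b c : ℝ) *
        (⟪v (C.freeA c), intVec (C.slot (C.freeB c))⟫ +
          ⟪v (C.freeB c), intVec (C.slot (C.freeA c))⟫) ≤
      Real.sqrt C.N * ((C.B i₀ a b : ℝ) / 4) * ε ^ 2 := by
    have ho : ∑ c : Fin C.nO, (C.lamO i₀ a b c : ℝ) * ⟪v (C.ownBall c), intVec (C.ownVec c)⟫ ≤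
        ∑ c : Fin C.nO, (C.lamO i₀ a b c : ℝ) * (Real.sqrt C.N * (ε ^ 2 / 4)) :=
      Finset.sum_le_sum fun c _ => mul_le_mul_of_nonneg_left (hownb c) (by positivity)
    have hf : ∑ c : Fin C.nF, (C.lamF i₀ a b c : ℝ) *
        (⟪v (C.freeA c), intVec (C.slot (C.freeB c))⟫ +
          ⟪v (C.freeB c), intVec (C.slot (C.freeA c))⟫) ≤
        ∑ c : Fin C.nF, (C.lamF i₀ a b c : ℝ) * (Real.sqrt C.N * (3 / 2 * ε ^ 2)) :=
      Finset.sum_le_sum fun c _ => mul_le_mul_of_nonneg_left (hfreeb c) (by positivity)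
    rw [← Finset.sum_mul] at ho hf
    have hB : (C.B i₀ a b : ℝ) = (∑ c : Fin C.nO, (C.lamO i₀ a b c : ℝ)) +
        6 * ∑ c : Fin C.nF, (C.lamF i₀ a b c : ℝ) := by
      simp [ConeCert.B]
    rw [hB]
    nlinarith [ho, hf]
  -- combine: (r‖T‖/√2) ‖v i₀‖ ≤ √N (B/4) ε², square, and compare with the ρ-check
  have hεz : ε = 0 := by
    by_contra hne
    have hpos : 0 < ε := lt_of_le_of_ne hε0 (Ne.symm hne)
    have hsq2 : Real.sqrt 2 ^ 2 = 2 := Real.sq_sqrt (by norm_num)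
    have hsqN : Real.sqrt (C.N : ℝ) ^ 2 = C.N := Real.sq_sqrt (by positivity)
    have hL0 : 0 ≤ (C.r i₀ a b : ℝ) * ‖Ta‖ / Real.sqrt 2 * ‖v i₀‖ := by positivity
    have hchain : (C.r i₀ a b : ℝ) * ‖Ta‖ / Real.sqrt 2 * ‖v i₀‖ ≤
        Real.sqrt C.N * ((C.B i₀ a b : ℝ) / 4) * ε ^ 2 := hagg.trans hup
    have hsq : ((C.r i₀ a b : ℝ) * ‖Ta‖ / Real.sqrt 2 * ‖v i₀‖) ^ 2 ≤
        (Real.sqrt C.N * ((C.B i₀ a b : ℝ) / 4) * ε ^ 2) ^ 2 := pow_le_pow_left₀ hL0 hchain 2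
    have hL : ((C.r i₀ a b : ℝ) * ‖Ta‖ / Real.sqrt 2 * ‖v i₀‖) ^ 2 =
        (C.r i₀ a b : ℝ) ^ 2 * ‖Ta‖ ^ 2 / 2 * (ε ^ 2 - ε ^ 4 / 4) := by
      rw [mul_pow, div_pow, mul_pow, hsq2, hvsq]
    have hR : (Real.sqrt C.N * ((C.B i₀ a b : ℝ) / 4) * ε ^ 2) ^ 2 =
        (C.N : ℝ) * (C.B i₀ a b : ℝ) ^ 2 / 16 * ε ^ 4 := by
      rw [mul_pow, mul_pow, hsqN]; ring
    rw [hL, hR] at hsq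
    -- hsq : r²‖T‖²/2 (ε² − ε⁴/4) ≤ N B²/16 ε⁴
    -- the ρ-check in reals: ρ² (N B² + 2 r²‖T‖²) ≤ 8 r² ‖T‖²
    have hρ : ((p : ℝ) / q) ^ 2 * ((C.N : ℝ) * (C.B i₀ a b : ℝ) ^ 2 + 2 * ((C.r i₀ a b : ℝ) ^ 2 * ‖Ta‖ ^ 2)) ≤
        8 * ((C.r i₀ a b : ℝ) ^ 2 * ‖Ta‖ ^ 2) := by
      have h := hrho i₀ a b
      have hden : (0 : ℝ) < q := by exact_mod_cast hrden
      have h' : (p : ℝ) ^ 2 * ((C.N : ℝ) * (C.B i₀ a b : ℝ) ^ 2 +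
          2 * (C.r i₀ a b : ℝ) ^ 2 * ‖Ta‖ ^ 2) ≤
          8 * (C.r i₀ a b : ℝ) ^ 2 * ‖Ta‖ ^ 2 * (q : ℝ) ^ 2 := by
        rw [hna]; exact_mod_cast h
      rw [div_pow]
      have hd2 : (0 : ℝ) < (q : ℝ) ^ 2 := by positivity
      calc (p : ℝ) ^ 2 / (q : ℝ) ^ 2 *
            ((C.N : ℝ) * (C.B i₀ a b : ℝ) ^ 2 + 2 * ((C.r i₀ a b : ℝ) ^ 2 * ‖Ta‖ ^ 2))
          = ((p : ℝ) ^ 2 * ((C.N : ℝ) * (C.B i₀ a b : ℝ) ^ 2 +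
              2 * (C.r i₀ a b : ℝ) ^ 2 * ‖Ta‖ ^ 2)) / (q : ℝ) ^ 2 := by ring
        _ ≤ (8 * (C.r i₀ a b : ℝ) ^ 2 * ‖Ta‖ ^ 2 * (q : ℝ) ^ 2) / (q : ℝ) ^ 2 :=
            div_le_div_of_nonneg_right h' hd2.le
        _ = 8 * ((C.r i₀ a b : ℝ) ^ 2 * ‖Ta‖ ^ 2) := by field_simp
    have hε2 : 0 < ε ^ 2 := by positivity
    have hερ2 : ε ^ 2 < ((p : ℝ) / q) ^ 2 := pow_lt_pow_left₀ hερ hε0 two_ne_zero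
    have hA2 : 0 < (C.r i₀ a b : ℝ) ^ 2 * ‖Ta‖ ^ 2 := by positivity
    -- from hsq (×16): 8 A2 ε² ≤ ε⁴ (N B² + 2 A2), then divide by ε²
    have k2 : 8 * ((C.r i₀ a b : ℝ) ^ 2 * ‖Ta‖ ^ 2) ≤
        ε ^ 2 * ((C.N : ℝ) * (C.B i₀ a b : ℝ) ^ 2 + 2 * ((C.r i₀ a b : ℝ) ^ 2 * ‖Ta‖ ^ 2)) := by
      have h : ε ^ 2 * (8 * ((C.r i₀ a b : ℝ) ^ 2 * ‖Ta‖ ^ 2)) ≤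
          ε ^ 2 * (ε ^ 2 * ((C.N : ℝ) * (C.B i₀ a b : ℝ) ^ 2 +
            2 * ((C.r i₀ a b : ℝ) ^ 2 * ‖Ta‖ ^ 2))) := by
        have e : ε ^ 2 * (ε ^ 2 * ((C.N : ℝ) * (C.B i₀ a b : ℝ) ^ 2 +
            2 * ((C.r i₀ a b : ℝ) ^ 2 * ‖Ta‖ ^ 2))) =
            (C.N : ℝ) * (C.B i₀ a b : ℝ) ^ 2 * ε ^ 4 +
              2 * ((C.r i₀ a b : ℝ) ^ 2 * ‖Ta‖ ^ 2) * ε ^ 4 := by ring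
        rw [e]; linarith only [hsq]
      exact le_of_mul_le_mul_left h hε2
    have hcoef : (0 : ℝ) < (C.N : ℝ) * (C.B i₀ a b : ℝ) ^ 2 + 2 * ((C.r i₀ a b : ℝ) ^ 2 * ‖Ta‖ ^ 2) := by
      positivity
    have k3 : ε ^ 2 * ((C.N : ℝ) * (C.B i₀ a b : ℝ) ^ 2 + 2 * ((C.r i₀ a b : ℝ) ^ 2 * ‖Ta‖ ^ 2)) <
        ((p : ℝ) / q) ^ 2 * ((C.N : ℝ) * (C.B i₀ a b : ℝ) ^ 2 + 2 * ((C.r i₀ a b : ℝ) ^ 2 * ‖Ta‖ ^ 2)) :=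
      mul_lt_mul_of_pos_right hερ2 hcoef
    linarith only [k2, k3, hρ]
  funext i
  have : ‖x i - C.s i‖ ≤ 0 := by rw [← hεz]; exact hεi i
  have h0 : x i - C.s i = 0 := norm_le_zero_iff.1 this
  exact sub_eq_zero.1 h0

/-- Distance form with the certified aggregate radius `ρ`. -/
theorem eq_slots_rho_dist (hV : C.check = true) {p q : ℕ} (hρ : C.rhoCheck p q = true)
    {x : Fin m → (EuclideanSpace ℝ (Fin 3))} (hx : ∀ i, ‖x i‖ = 1)
    (hxo : ∀ i, ∀ o ∈ C.ownSet, 1 ≤ dist (x i) o) (hxx : ∀ i j, i ≠ j → 1 ≤ dist (x i) (x j))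
    (hclose : ∀ i, dist (x i) (C.s i) < (p : ℝ) / q) : x = C.s :=
  C.eq_slots_rho hV hρ hx
    (fun i o ho _ => inner_le_half_of_one_le_dist (hx i) (C.norm_own hV o ho) (hxo i o ho))
    (fun i j hij _ => inner_le_half_of_one_le_dist (hx i) (hx j) (hxx i j hij))
    (fun i => by rw [← dist_eq_norm]; exact hclose i)

/-! ### Finset form (E1 ↔ E2 interface): `EtaMatched` to the slot set -/

/-- The slot map is injective when the integer slots are distinct (one `decide` per certificate). -/
theorem s_injective (hV : C.check = true) (hinj : ∀ i j, C.slot i = C.slot j → i = j) :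
    Function.Injective C.s := by
  unfold ConeCert.check at hV
  obtain ⟨hN, -⟩ := of_decide_eq_true hV
  intro i j hij
  have hc : (Real.sqrt C.N)⁻¹ ≠ 0 := (inv_pos.2 (C.sqrtN_pos hN)).ne'
  have h1 : intVec (C.slot i) = intVec (C.slot j) := smul_right_injective _ hc hij
  exact hinj i j (intVec_injective h1)

/-- The slot set in pattern language: `{s i} = scaledPattern {slot i} N`. -/
theorem image_s_eq_scaledPattern :
    Finset.univ.image C.s = scaledPattern (Finset.univ.image C.slot) C.N := by
  classical
  unfold scaledPattern
  rw [Finset.image_image]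
  rfl

/-- The active own set in pattern language: `ownSet = scaledPattern {ownVec c} N`. -/
theorem ownSet_eq_scaledPattern :
    C.ownSet = scaledPattern (Finset.univ.image C.ownVec) C.N := by
  classical
  unfold scaledPattern ConeCert.ownSet
  rw [Finset.image_image]
  rfl

/-- From an INDEXED tube statement (`x : Fin m → ℝ³` within the tube ⇒ `x = C.s`) to the FINSET
statement: a finite set `T` of unit vectors keeping distance `≥ 1` from the active own balls and
pairwise, `η`-matched (`EtaMatched`, Literature `KissingPatterns`) to the slot set with `η < ρ`, IS
the slot set. -/
theorem eq_slotSet_of_etaMatched_aux {ρ η : ℝ} (hη : η < ρ) (hsinj : Function.Injective C.s)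
    (htube : ∀ x : Fin m → (EuclideanSpace ℝ (Fin 3)), (∀ i, ‖x i‖ = 1) →
      (∀ i, ∀ o ∈ C.ownSet, 1 ≤ dist (x i) o) → (∀ i j, i ≠ j → 1 ≤ dist (x i) (x j)) →
      (∀ i, dist (x i) (C.s i) < ρ) → x = C.s)
    {T : Finset (EuclideanSpace ℝ (Fin 3))} (hT1 : ∀ t ∈ T, ‖t‖ = 1)
    (hTo : ∀ t ∈ T, ∀ o ∈ C.ownSet, 1 ≤ dist t o)
    (hTT : ∀ t ∈ T, ∀ t' ∈ T, t ≠ t' → 1 ≤ dist t t')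
    (hm : EtaMatched η T (Finset.univ.image C.s)) : T = Finset.univ.image C.s := by
  classical
  obtain ⟨e, he⟩ := hm
  -- the slot `i` as an element of the image, and its partner in `T`
  have hmem : ∀ i, C.s i ∈ Finset.univ.image C.s := fun i =>
    Finset.mem_image_of_mem _ (Finset.mem_univ i)
  set y : Fin m → ↥(Finset.univ.image C.s) := fun i => ⟨C.s i, hmem i⟩ with hy
  set x : Fin m → (EuclideanSpace ℝ (Fin 3)) := fun i => ((e.symm (y i) : ↥T) : EuclideanSpace ℝ (Fin 3))
    with hx
  have hxT : ∀ i, x i ∈ T := fun i => (e.symm (y i)).prop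
  have hxclose : ∀ i, dist (x i) (C.s i) < ρ := by
    intro i
    have h := he (e.symm (y i))
    rw [Equiv.apply_symm_apply] at h
    exact lt_of_le_of_lt h hη
  have hxinj : ∀ i j, i ≠ j → x i ≠ x j := by
    intro i j hij hxe
    apply hij
    have h1 : e.symm (y i) = e.symm (y j) := Subtype.ext hxe
    have h2 : y i = y j := e.symm.injective h1
    have h3 : C.s i = C.s j := by
      have := congrArg (fun z : ↥(Finset.univ.image C.s) => (z : EuclideanSpace ℝ (Fin 3))) h2
      simpa [hy] using this
    exact hsinj h3
  have hxs : x = C.s :=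
    htube x (fun i => hT1 _ (hxT i)) (fun i o ho => hTo _ (hxT i) o ho)
      (fun i j hij => hTT _ (hxT i) _ (hxT j) (hxinj i j hij)) hxclose
  -- conclude the two finsets are equal
  ext t
  constructor
  · intro ht
    obtain ⟨i, -, hi⟩ := Finset.mem_image.1 (e ⟨t, ht⟩).prop
    -- `e ⟨t, ht⟩ = y i`, hence `t = x i = C.s i`
    have h1 : e ⟨t, ht⟩ = y i := Subtype.ext (by rw [hy]; exact hi.symm)
    have h2 : (⟨t, ht⟩ : ↥T) = e.symm (y i) := by rw [← h1, Equiv.symm_apply_apply]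
    have h3 : t = x i := by
      have := congrArg (fun z : ↥T => (z : EuclideanSpace ℝ (Fin 3))) h2
      simpa [hx] using this
    rw [h3, hxs]; exact hmem i
  · intro ht
    obtain ⟨i, -, rfl⟩ := Finset.mem_image.1 ht
    have : x i = C.s i := congrFun hxs i
    rw [← this]; exact hxT i

/-- **Finset form with the aggregate radius `ρ = p/q`** (E1 ↔ E2 interface; centre `0`, pattern
coordinates): `T` = the free balls of an admissible completion of the active own set, `η`-matched to
the slot set with `η < p/q`, is the slot set. -/
theorem eq_slotSet_of_etaMatched (hV : C.check = true) {p q : ℕ} (hρ : C.rhoCheck p q = true)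
    (hinj : ∀ i j, C.slot i = C.slot j → i = j) {η : ℝ} (hη : η < (p : ℝ) / q)
    {T : Finset (EuclideanSpace ℝ (Fin 3))} (hT1 : ∀ t ∈ T, ‖t‖ = 1)
    (hTo : ∀ t ∈ T, ∀ o ∈ C.ownSet, 1 ≤ dist t o)
    (hTT : ∀ t ∈ T, ∀ t' ∈ T, t ≠ t' → 1 ≤ dist t t')
    (hm : EtaMatched η T (Finset.univ.image C.s)) : T = Finset.univ.image C.s :=
  C.eq_slotSet_of_etaMatched_aux hη (C.s_injective hV hinj)
    (fun _ hx hxo hxx hclose => C.eq_slots_rho_dist hV hρ hx hxo hxx hclose) hT1 hTo hTT hm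

/-- Finset form with the landed radius `κ₀/3` (no `rhoCheck` needed). -/
theorem eq_slotSet_of_etaMatched_kappa (hV : C.check = true)
    (hinj : ∀ i j, C.slot i = C.slot j → i = j) {η : ℝ} (hη : η < C.kappa / 3)
    {T : Finset (EuclideanSpace ℝ (Fin 3))} (hT1 : ∀ t ∈ T, ‖t‖ = 1)
    (hTo : ∀ t ∈ T, ∀ o ∈ C.ownSet, 1 ≤ dist t o)
    (hTT : ∀ t ∈ T, ∀ t' ∈ T, t ≠ t' → 1 ≤ dist t t')
    (hm : EtaMatched η T (Finset.univ.image C.s)) : T = Finset.univ.image C.s :=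
  C.eq_slotSet_of_etaMatched_aux hη (C.s_injective hV hinj)
    (fun _ hx hxo hxx hclose => C.eq_slots_dist hV hx hxo hxx hclose) hT1 hTo hTT hm

end ConeCert

end Summit.Ventures.Crystal3D.Theorems

end
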